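import Literature.Analysis.Complex.PlanePotentialEstimates
import Literature.Analysis.Complex.HartmanWintnerDensity
import Mathlib.MeasureTheory.Integral.Lebesgue.Countable
import HarnessLib

/-!
# Hartman–Wintner: Carleman's integral bootstrap for `|∂̄w| ≤ K|w|`

The analytic heart of the Hartman–Wintner theorem on the local behaviour of `C¹` solutions
`w : B(0, r) → F` (`F` a complex Banach space) of the differential inequality `‖∂̄w‖ ≤ K ‖w‖`
(Hartman–Wintner (1953); Schulz (1990), Thm 7.1.1 and its proof, formulas (7.5)–(7.7)).

**Setting** (hypotheses `hρm … hmw` of the section, as in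
`Literature/Analysis/Complex/HartmanWintnerDensity.lean` and `HartmanWintner.lean`): radii `0 < ρₘ < ρ < r`, `w ∈ C¹(B(0,r))` with
`‖∂̄w‖ ≤ K‖w‖` there (`∂̄ = dbarAlong 1`, `K ≥ 0`), a `C¹` cut-off `χ` (`= 1` on `B̄(0, ρₘ)`,
`tsupport χ ⊆ B(0, ρ)`, `‖χ‖ ≤ 1`, `‖∂̄χ‖ ≤ L`) and `m = sup_{B̄(0,ρ)} ‖w‖`. Put `φ = χ • w ∈ C¹_c(ℂ, F)`.

**The bootstrap** (`norm_le_of_stage`). Fix `k : ℕ`. Suppose `w = O(|z|^{k-1})` on `B̄(0, ρₘ)`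
(qualitatively: `|z| ‖w z‖ ≤ M |z|^k`) and the Cauchy–Green representation of order `k`,

  `π z^{-k} w(ζ) = ∫ (ζ - z)⁻¹ z^{-k} ∂̄φ(z) dA(z)`   (`0 < |ζ| ≤ ρₘ`),

holds. If `16 ρₘ K ≤ 1` then `‖w(ζ)‖ ≤ 4(ρ + ρₘ)(L + K) m · (|ζ|/ρₘ)^k` for `0 < |ζ| ≤ ρₘ` — a
bound of order `k` whose constant does NOT depend on `k`. Proof (Schulz, (7.6)–(7.7)): with
`u = ‖w‖ |z|^{-k}` and `I(z₀) = ∫_{B(0,ρₘ)} u(ζ) |z₀ - ζ|⁻¹ dA(ζ)` the representation gives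
`π u(ζ) ≤ K I(ζ) + πβ` (`β = 2(ρ+ρₘ)(L+K) m ρₘ^{-k}` from the annulus `ρₘ ≤ |z| < ρ`); multiplying
by `|z₀ - ζ|⁻¹`, integrating (Tonelli) and using the two-pole estimate
`∫ |ζ - z|⁻¹ |z₀ - ζ|⁻¹ dA(ζ) ≤ 8πρₘ |z - z₀|⁻¹` gives `π I ≤ 8πρₘ K · I + 4π²ρₘ β`, and `I < ∞`
(because `u = O(|z|⁻¹)`), whence `I ≤ 8πρₘβ` and `u ≤ 2β`.

The elementary facts about `φ` and the densities `f_k = z^{-k} ∂̄φ` used here are in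
`HartmanWintnerDensity.lean`.

## References

* P. Hartman, A. Wintner, *On the local behavior of solutions of non-parabolic partial
  differential equations*, Amer. J. Math. 75 (1953), 449–476. [HartmanWintner1953]
* F. Schulz, *Regularity theory for quasilinear elliptic systems and Monge–Ampère equations in two
  dimensions*, Springer LNM 1445 (1990), §7.1, Thm 7.1.1. [SchulzRegularity1990]
-/

noncomputable section

open MeasureTheory Metric Set Filter Topology Complex
open scoped Real ENNReal ContDiff

namespace Literature.Analysis.Complex

namespace HartmanWintner

variable {F : Type*} [NormedAddCommGroup F] [NormedSpace ℂ F]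
variable {w : ℂ → F} {χ : ℂ → ℂ} {K L m r ρ ρm : ℝ}

/-! ### The bootstrap -/

section Bootstrap

variable (hρm : 0 < ρm) (hρ : ρm < ρ) (hr : ρ < r) (hw : ContDiffOn ℝ 1 w (ball 0 r))
  (hK : 0 ≤ K) (hdbar : ∀ z ∈ ball (0 : ℂ) r, ‖dbarAlong 1 w z‖ ≤ K * ‖w z‖)
  (hχ : ContDiff ℝ 1 χ) (hχ1 : ∀ z : ℂ, ‖z‖ ≤ ρm → χ z = 1) (hχs : tsupport χ ⊆ ball 0 ρ)
  (hχle : ∀ z, ‖χ z‖ ≤ 1) (hL : 0 ≤ L) (hLχ : ∀ z, ‖dbarAlong 1 χ z‖ ≤ L)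
  (hm : 0 ≤ m) (hmw : ∀ z : ℂ, ‖z‖ < ρ → ‖w z‖ ≤ m)

include hρm hρ hr hw hK hdbar hχ hχ1 hχs hχle hL hLχ hm hmw in
/-- **Carleman–Hartman–Wintner bootstrap** (Schulz (1990), proof of Thm 7.1.1, (7.5)–(7.7)). In the
setting of this file, let `k : ℕ`, assume `16 ρₘ K ≤ 1`, the qualitative bound
`|z| ‖w z‖ ≤ M |z|^k` on `B̄(0, ρₘ)` (i.e. `w = O(|z|^{k-1})`) and the order-`k` Cauchy–Green
representation `π ζ^{-k} w(ζ) = ∫ (ζ - z)⁻¹ z^{-k} ∂̄φ(z) dA(z)` for `0 < |ζ| ≤ ρₘ`. Then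
`‖w ζ‖ ≤ 4 (ρ + ρₘ)(L + K) m ρₘ^{-k} |ζ|^k` for `0 < |ζ| ≤ ρₘ`.
[cite: SchulzRegularity1990, §7.1 Thm 7.1.1 (proof, (7.5)–(7.7))] -/
theorem norm_le_of_stage (k : ℕ) (hsmall : 16 * ρm * K ≤ 1)
    (hO : ∃ M : ℝ, ∀ z : ℂ, ‖z‖ ≤ ρm → ‖z‖ * ‖w z‖ ≤ M * ‖z‖ ^ k)
    (hR : ∀ ζ : ℂ, 0 < ‖ζ‖ → ‖ζ‖ ≤ ρm → ((π : ℂ) * (ζ ^ k)⁻¹) • w ζ =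
      ∫ z, (ζ - z)⁻¹ • ((z ^ k)⁻¹ • dbarAlong 1 (fun y => χ y • w y) z))
    {ζ : ℂ} (hζ0 : 0 < ‖ζ‖) (hζ : ‖ζ‖ ≤ ρm) :
    ‖w ζ‖ ≤ 4 * (ρ + ρm) * (L + K) * m * (ρm ^ k)⁻¹ * ‖ζ‖ ^ k := by
  -- notation
  set φ : ℂ → F := fun y => χ y • w y with hφ_def
  have hρ0 : 0 < ρ := hρm.trans hρ
  set β : ℝ := 2 * (ρ + ρm) * (L + K) * m * (ρm ^ k)⁻¹ with hβ_def
  have hβ : 0 ≤ β := by rw [hβ_def]; positivity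
  set u : ℂ → ℝ≥0∞ := fun z => ENNReal.ofReal (‖φ z‖ * (‖z‖ ^ k)⁻¹) with hu_def
  set I : ℂ → ℝ≥0∞ := fun z₀ => ∫⁻ ζ in ball (0 : ℂ) ρm, u ζ * ENNReal.ofReal ‖z₀ - ζ‖⁻¹
    with hI_def
  have hφc : Continuous φ := (contDiff_phi hr hw hχ hχs).continuous
  have hu_meas : Measurable u :=
    (hφc.norm.measurable.mul ((measurable_norm.pow_const k).inv)).ennreal_ofReal
  have hφw : ∀ z : ℂ, ‖z‖ ≤ ρm → φ z = w z := fun z hz => by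
    simp [hφ_def, hχ1 z hz]
  have hB : MeasurableSet (ball (0 : ℂ) ρm) := measurableSet_ball
  have hae0 : ∀ᵐ z : ℂ ∂volume, z ≠ 0 := compl_mem_ae_iff.2 (measure_singleton (0 : ℂ))
  -- Step 1: the pointwise inequality `π u(ζ) ≤ K I(ζ) + π β` from the representation
  have hstar : ∀ η : ℂ, 0 < ‖η‖ → ‖η‖ ≤ ρm →
      ENNReal.ofReal (π * (‖w η‖ * (‖η‖ ^ k)⁻¹)) ≤
        ENNReal.ofReal K * I η + ENNReal.ofReal (π * β) := by
    intro η hη0 hη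
    have hrep := hR η hη0 hη
    have hnorm : ‖((π : ℂ) * (η ^ k)⁻¹) • w η‖ = π * (‖w η‖ * (‖η‖ ^ k)⁻¹) := by
      rw [norm_smul, norm_mul, norm_real, Real.norm_of_nonneg Real.pi_pos.le, norm_inv, norm_pow]
      ring
    rw [← hnorm, hrep]
    refine (ENNReal.ofReal_le_of_le_toReal (norm_integral_le_lintegral_norm _)).trans ?_
    rw [← lintegral_add_compl _ hB]
    gcongr
    · -- inner region `|z| < ρₘ`
      calc ∫⁻ z in ball (0 : ℂ) ρm, ENNReal.ofReal ‖(η - z)⁻¹ • ((z ^ k)⁻¹ • dbarAlong 1 φ z)‖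
          ≤ ∫⁻ z in ball (0 : ℂ) ρm, ENNReal.ofReal K * (u z * ENNReal.ofReal ‖η - z‖⁻¹) := by
            refine setLIntegral_mono' hB fun z hz => ?_
            have hz' : ‖z‖ < ρm := mem_ball_zero_iff.1 hz
            rw [hu_def]
            dsimp only
            rw [← ENNReal.ofReal_mul (by positivity), ← ENNReal.ofReal_mul hK, norm_smul,
              norm_inv, norm_smul, norm_inv, norm_pow]
            refine ENNReal.ofReal_le_ofReal ?_
            have hb := norm_dbar_phi_le_inner hρ hr hw hχ hdbar hχ1 hχle hz'
            rw [hφw z hz'.le]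
            calc ‖η - z‖⁻¹ * ((‖z‖ ^ k)⁻¹ * ‖dbarAlong 1 φ z‖)
                ≤ ‖η - z‖⁻¹ * ((‖z‖ ^ k)⁻¹ * (K * ‖w z‖)) := by gcongr
              _ = K * (‖w z‖ * (‖z‖ ^ k)⁻¹ * ‖η - z‖⁻¹) := by ring
        _ = ENNReal.ofReal K * I η := by
            rw [hI_def, lintegral_const_mul' _ _ ENNReal.ofReal_ne_top]
    · -- annulus `ρₘ ≤ |z|` (and nothing beyond `ρ`)
      calc ∫⁻ z in (ball (0 : ℂ) ρm)ᶜ, ENNReal.ofReal ‖(η - z)⁻¹ • ((z ^ k)⁻¹ • dbarAlong 1 φ z)‖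
          ≤ ∫⁻ z in (ball (0 : ℂ) ρm)ᶜ, (ball (0 : ℂ) ρ).indicator
              (fun z => ENNReal.ofReal ((L + K) * m * (ρm ^ k)⁻¹) *
                ENNReal.ofReal ‖η - z‖⁻¹) z := by
            refine setLIntegral_mono' hB.compl fun z hz => ?_
            have hz' : ρm ≤ ‖z‖ := not_lt.1 fun h => hz (mem_ball_zero_iff.2 h)
            by_cases hzρ : ‖z‖ < ρ
            · rw [indicator_of_mem (mem_ball_zero_iff.2 hzρ), ← ENNReal.ofReal_mul (by positivity),
                norm_smul, norm_inv, norm_smul, norm_inv, norm_pow]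
              refine ENNReal.ofReal_le_ofReal ?_
              have hb := norm_dbar_phi_le hw hχ hdbar hχle hLχ (hzρ.trans hr)
              calc ‖η - z‖⁻¹ * ((‖z‖ ^ k)⁻¹ * ‖dbarAlong 1 φ z‖)
                  ≤ ‖η - z‖⁻¹ * ((ρm ^ k)⁻¹ * ((L + K) * m)) := by
                    refine mul_le_mul_of_nonneg_left (mul_le_mul ?_ (hb.trans ?_) (norm_nonneg _)
                      (by positivity)) (inv_nonneg.2 (norm_nonneg _))
                    · exact inv_anti₀ (by positivity) (pow_le_pow_left₀ hρm.le hz' k)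
                    · exact mul_le_mul_of_nonneg_left (hmw z hzρ) (by positivity)
                _ = (L + K) * m * (ρm ^ k)⁻¹ * ‖η - z‖⁻¹ := by ring
            · rw [not_lt] at hzρ
              have : dbarAlong 1 φ z = 0 := dbar_phi_eq_zero hχs hzρ
              simp [this]
        _ ≤ ∫⁻ z, (ball (0 : ℂ) ρ).indicator
              (fun z => ENNReal.ofReal ((L + K) * m * (ρm ^ k)⁻¹) *
                ENNReal.ofReal ‖η - z‖⁻¹) z := setLIntegral_le_lintegral _ _
        _ = ENNReal.ofReal ((L + K) * m * (ρm ^ k)⁻¹) *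
              ∫⁻ z in ball (0 : ℂ) ρ, ENNReal.ofReal ‖η - z‖⁻¹ := by
            rw [lintegral_indicator measurableSet_ball,
              lintegral_const_mul' _ _ ENNReal.ofReal_ne_top]
        _ ≤ ENNReal.ofReal ((L + K) * m * (ρm ^ k)⁻¹) *
              ENNReal.ofReal (2 * π * (ρ + ‖η - 0‖)) := by
            gcongr
            exact lintegral_inv_norm_sub_ball_le 0 η (by linarith)
        _ ≤ ENNReal.ofReal ((L + K) * m * (ρm ^ k)⁻¹) *
              ENNReal.ofReal (2 * π * (ρ + ρm)) := by
            gcongr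
            rwa [sub_zero]
        _ = ENNReal.ofReal (π * β) := by
            rw [← ENNReal.ofReal_mul (by positivity), hβ_def]
            ring_nf
  -- Step 2: `I z₀ < ∞` for `z₀ ≠ 0` (because `u = O(|z|⁻¹)`)
  obtain ⟨M, hM⟩ := hO
  have hIfin : ∀ z₀ : ℂ, z₀ ≠ 0 → ‖z₀‖ ≤ ρm → I z₀ ≠ ⊤ := by
    intro z₀ hz₀ hz₀'
    have hM0 : ∀ z : ℂ, z ≠ 0 → ‖z‖ ≤ ρm → ‖w z‖ * (‖z‖ ^ k)⁻¹ ≤ max M 0 * ‖z‖⁻¹ := by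
      intro z hz hz'
      have hzpos : 0 < ‖z‖ := norm_pos_iff.2 hz
      have h := hM z hz'
      rw [mul_comm] at h
      have h' : ‖w z‖ ≤ M * ‖z‖ ^ k * ‖z‖⁻¹ := by
        rw [← div_eq_mul_inv, le_div_iff₀ hzpos]; exact h
      calc ‖w z‖ * (‖z‖ ^ k)⁻¹ ≤ M * ‖z‖ ^ k * ‖z‖⁻¹ * (‖z‖ ^ k)⁻¹ := by gcongr
        _ = M * ‖z‖⁻¹ * (‖z‖ ^ k * (‖z‖ ^ k)⁻¹) := by ring
        _ = M * ‖z‖⁻¹ := by rw [mul_inv_cancel₀ (by positivity), mul_one]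
        _ ≤ max M 0 * ‖z‖⁻¹ := by gcongr; exact le_max_left _ _
    have hle : I z₀ ≤ ENNReal.ofReal (max M 0) *
        ∫⁻ ζ in ball (0 : ℂ) ρm, ENNReal.ofReal (‖(0 : ℂ) - ζ‖⁻¹ * ‖ζ - z₀‖⁻¹) := by
      rw [hI_def, ← lintegral_const_mul' _ _ ENNReal.ofReal_ne_top]
      refine setLIntegral_mono_ae' hB ?_
      filter_upwards [hae0] with ζ hζne hζB
      have hζ' : ‖ζ‖ ≤ ρm := (mem_ball_zero_iff.1 hζB).le
      rw [hu_def]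
      dsimp only
      rw [hφw ζ hζ', ← ENNReal.ofReal_mul (by positivity), ← ENNReal.ofReal_mul (by positivity),
        zero_sub, norm_neg, norm_sub_rev ζ z₀]
      refine ENNReal.ofReal_le_ofReal ?_
      calc ‖w ζ‖ * (‖ζ‖ ^ k)⁻¹ * ‖z₀ - ζ‖⁻¹ ≤ max M 0 * ‖ζ‖⁻¹ * ‖z₀ - ζ‖⁻¹ :=
            mul_le_mul_of_nonneg_right (hM0 ζ hζne hζ') (inv_nonneg.2 (norm_nonneg _))
        _ = max M 0 * (‖ζ‖⁻¹ * ‖z₀ - ζ‖⁻¹) := by ring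
    have h2 := lintegral_inv_norm_sub_mul_inv_norm_sub_le (c := (0 : ℂ)) (z := 0) (z₀ := z₀)
      hρm.le (by simpa using hρm.le) (by simpa using hz₀') (Ne.symm hz₀)
    exact ne_top_of_le_ne_top (ENNReal.mul_ne_top ENNReal.ofReal_ne_top ENNReal.ofReal_ne_top)
      (hle.trans (mul_le_mul' le_rfl h2))
  -- Step 3: the integrated inequality `π I(z₀) ≤ 8πρₘK I(z₀) + 4π²ρₘ β`
  have hII : ∀ z₀ : ℂ, z₀ ≠ 0 → ‖z₀‖ ≤ ρm →
      ENNReal.ofReal π * I z₀ ≤ ENNReal.ofReal K * ENNReal.ofReal (8 * π * ρm) * I z₀ +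
        ENNReal.ofReal (π * β) * ENNReal.ofReal (2 * π * (ρm + ρm)) := by
    intro z₀ hz₀ hz₀'
    -- integrate `hstar` against `|z₀ - ζ|⁻¹` over `ζ ∈ B(0, ρₘ)`
    have h1 : ENNReal.ofReal π * I z₀ ≤
        ∫⁻ ζ in ball (0 : ℂ) ρm, (ENNReal.ofReal K * I ζ + ENNReal.ofReal (π * β)) *
          ENNReal.ofReal ‖z₀ - ζ‖⁻¹ := by
      rw [hI_def, ← lintegral_const_mul' _ _ ENNReal.ofReal_ne_top]
      refine setLIntegral_mono_ae' hB ?_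
      filter_upwards [hae0] with ζ hζne hζB
      have hζ' : ‖ζ‖ ≤ ρm := (mem_ball_zero_iff.1 hζB).le
      rw [← mul_assoc]
      gcongr
      rw [hu_def]
      dsimp only
      rw [hφw ζ hζ', ← ENNReal.ofReal_mul Real.pi_pos.le]
      exact hstar ζ (norm_pos_iff.2 hζne) hζ'
    refine h1.trans ?_
    have hmeas2 : Measurable fun ζ : ℂ => ENNReal.ofReal (π * β) * ENNReal.ofReal ‖z₀ - ζ‖⁻¹ := by
      fun_prop
    simp_rw [add_mul]
    rw [lintegral_add_right _ hmeas2, lintegral_const_mul' _ _ ENNReal.ofReal_ne_top]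
    gcongr ?_ + ENNReal.ofReal (π * β) * ?_
    · -- the double integral, via Tonelli and the two-pole estimate
      have hker : Measurable fun p : ℂ × ℂ =>
          u p.2 * ENNReal.ofReal ‖p.1 - p.2‖⁻¹ * ENNReal.ofReal ‖z₀ - p.1‖⁻¹ :=
        ((hu_meas.comp measurable_snd).mul
          (measurable_fst.sub measurable_snd).norm.inv.ennreal_ofReal).mul
          (measurable_const.sub measurable_fst).norm.inv.ennreal_ofReal
      calc ∫⁻ ζ in ball (0 : ℂ) ρm, ENNReal.ofReal K * I ζ * ENNReal.ofReal ‖z₀ - ζ‖⁻¹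
          = ENNReal.ofReal K * ∫⁻ ζ in ball (0 : ℂ) ρm, ∫⁻ z in ball (0 : ℂ) ρm,
              u z * ENNReal.ofReal ‖ζ - z‖⁻¹ * ENNReal.ofReal ‖z₀ - ζ‖⁻¹ := by
            rw [← lintegral_const_mul' _ _ ENNReal.ofReal_ne_top]
            refine lintegral_congr fun ζ => ?_
            rw [mul_assoc, hI_def]
            dsimp only
            rw [← lintegral_mul_const' _ _ ENNReal.ofReal_ne_top]
        _ = ENNReal.ofReal K * ∫⁻ z in ball (0 : ℂ) ρm, ∫⁻ ζ in ball (0 : ℂ) ρm,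
              u z * ENNReal.ofReal ‖ζ - z‖⁻¹ * ENNReal.ofReal ‖z₀ - ζ‖⁻¹ := by
            rw [lintegral_lintegral_swap (hker.aemeasurable)]
        _ = ENNReal.ofReal K * ∫⁻ z in ball (0 : ℂ) ρm, u z * ∫⁻ ζ in ball (0 : ℂ) ρm,
              ENNReal.ofReal (‖z - ζ‖⁻¹ * ‖ζ - z₀‖⁻¹) := by
            congr 1
            refine lintegral_congr fun z => ?_
            simp_rw [mul_assoc]
            rw [lintegral_const_mul' _ _ ENNReal.ofReal_ne_top]
            congr 1
            refine lintegral_congr fun ζ => ?_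
            rw [← ENNReal.ofReal_mul (by positivity), norm_sub_rev z ζ, norm_sub_rev ζ z₀]
        _ ≤ ENNReal.ofReal K * ∫⁻ z in ball (0 : ℂ) ρm,
              u z * ENNReal.ofReal (8 * π * ρm * ‖z - z₀‖⁻¹) := by
            gcongr ENNReal.ofReal K * ?_
            refine setLIntegral_mono_ae' hB ?_
            have hae : ∀ᵐ z : ℂ ∂volume, z ≠ z₀ :=
              compl_mem_ae_iff.2 (measure_singleton z₀)
            filter_upwards [hae] with z hzne hzB
            gcongr
            exact lintegral_inv_norm_sub_mul_inv_norm_sub_le hρm.le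
              (by simpa using (mem_ball_zero_iff.1 hzB).le) (by simpa using hz₀') hzne
        _ = ENNReal.ofReal K * (ENNReal.ofReal (8 * π * ρm) * I z₀) := by
            congr 1
            rw [hI_def]
            dsimp only
            rw [← lintegral_const_mul' _ _ ENNReal.ofReal_ne_top]
            refine lintegral_congr fun z => ?_
            rw [ENNReal.ofReal_mul (by positivity), norm_sub_rev z z₀]
            ring
        _ = ENNReal.ofReal K * ENNReal.ofReal (8 * π * ρm) * I z₀ := by ring
    · calc ∫⁻ ζ in ball (0 : ℂ) ρm, ENNReal.ofReal ‖z₀ - ζ‖⁻¹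
          ≤ ENNReal.ofReal (2 * π * (ρm + ‖z₀ - 0‖)) := lintegral_inv_norm_sub_ball_le 0 z₀ hρm.le
        _ ≤ ENNReal.ofReal (2 * π * (ρm + ρm)) := by gcongr; rwa [sub_zero]
  -- Step 4: `I(z₀) ≤ 8πρₘ β`
  have hIle : ∀ z₀ : ℂ, z₀ ≠ 0 → ‖z₀‖ ≤ ρm → (I z₀).toReal ≤ 8 * π * ρm * β := by
    intro z₀ hz₀ hz₀'
    have hfin := hIfin z₀ hz₀ hz₀'
    have h := hII z₀ hz₀ hz₀'
    have h' := ENNReal.toReal_mono (by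
      apply ENNReal.add_ne_top.2
      constructor
      · exact ENNReal.mul_ne_top (ENNReal.mul_ne_top ENNReal.ofReal_ne_top ENNReal.ofReal_ne_top) hfin
      · exact ENNReal.mul_ne_top ENNReal.ofReal_ne_top ENNReal.ofReal_ne_top) h
    rw [ENNReal.toReal_mul, ENNReal.toReal_add
        (ENNReal.mul_ne_top (ENNReal.mul_ne_top ENNReal.ofReal_ne_top ENNReal.ofReal_ne_top) hfin)
        (ENNReal.mul_ne_top ENNReal.ofReal_ne_top ENNReal.ofReal_ne_top),
      ENNReal.toReal_mul, ENNReal.toReal_mul, ENNReal.toReal_mul,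
      ENNReal.toReal_ofReal Real.pi_pos.le, ENNReal.toReal_ofReal hK,
      ENNReal.toReal_ofReal (by positivity), ENNReal.toReal_ofReal (by positivity),
      ENNReal.toReal_ofReal (by positivity)] at h'
    have hI0 : 0 ≤ (I z₀).toReal := ENNReal.toReal_nonneg
    have hπ := Real.pi_pos
    -- `π I ≤ 8πρₘK I + 4π²ρₘβ` with `16ρₘK ≤ 1`
    have hk2 : K * (8 * π * ρm) * (I z₀).toReal ≤ π / 2 * (I z₀).toReal := by
      have h1 : K * (8 * π * ρm) = (16 * ρm * K) * (π / 2) := by ring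
      have : K * (8 * π * ρm) ≤ π / 2 := by
        rw [h1]
        calc 16 * ρm * K * (π / 2) ≤ 1 * (π / 2) :=
              mul_le_mul_of_nonneg_right hsmall (by positivity)
          _ = π / 2 := one_mul _
      exact mul_le_mul_of_nonneg_right this hI0
    nlinarith
  -- Step 5: back into `hstar`
  have hζne : ζ ≠ 0 := norm_pos_iff.1 hζ0
  have hfinal : π * (‖w ζ‖ * (‖ζ‖ ^ k)⁻¹) ≤ K * (8 * π * ρm * β) + π * β := by
    have h := hstar ζ hζ0 hζ
    have hI : I ζ ≤ ENNReal.ofReal (8 * π * ρm * β) := by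
      rw [← ENNReal.ofReal_toReal (hIfin ζ hζne hζ)]
      exact ENNReal.ofReal_le_ofReal (hIle ζ hζne hζ)
    have h2 : ENNReal.ofReal (π * (‖w ζ‖ * (‖ζ‖ ^ k)⁻¹)) ≤
        ENNReal.ofReal (K * (8 * π * ρm * β) + π * β) := by
      refine h.trans ?_
      rw [ENNReal.ofReal_add (by positivity) (by positivity), ENNReal.ofReal_mul hK]
      gcongr
    exact (ENNReal.ofReal_le_ofReal_iff (by positivity)).1 h2
  have hπ := Real.pi_pos
  have hk3 : K * (8 * π * ρm * β) ≤ π * β := by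
    have h1 : K * (8 * π * ρm * β) = (16 * ρm * K) * (π * β / 2) := by ring
    rw [h1]
    calc 16 * ρm * K * (π * β / 2) ≤ 1 * (π * β / 2) :=
          mul_le_mul_of_nonneg_right hsmall (by positivity)
      _ ≤ π * β := by rw [one_mul]; linarith [mul_nonneg hπ.le hβ]
  have h4 : ‖w ζ‖ * (‖ζ‖ ^ k)⁻¹ ≤ 2 * β := by
    refine le_of_mul_le_mul_left ?_ hπ
    linarith
  have hpow : 0 < ‖ζ‖ ^ k := by positivity
  calc ‖w ζ‖ = ‖w ζ‖ * (‖ζ‖ ^ k)⁻¹ * ‖ζ‖ ^ k := by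
        rw [mul_assoc, inv_mul_cancel₀ hpow.ne', mul_one]
    _ ≤ 2 * β * ‖ζ‖ ^ k := by gcongr
    _ = 4 * (ρ + ρm) * (L + K) * m * (ρm ^ k)⁻¹ * ‖ζ‖ ^ k := by rw [hβ_def]; ring

end Bootstrap

end HartmanWintner

end Literature.Analysis.Complex

end
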